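import Summits.HodgeConjecture.HodgeConjecture.Theorems.F0P3SpectralPacketRigidityReductionH   -- ★ LH7-p03 p848117: `SpectralPacketH.xiRigidityH_of_fibre`, `eq_of_loc_eq_of_discH_pins` (+ ★ p848041 Satake, ★ 3t `XiRigidityH`, ★ 3r `rhoXiS`, `memH_rhoXiS_loc`)
import Literature.NumberTheory.Rogawski1990.OneDimAutRepHCofiniteRigidity                        -- ★ LH7-p03 p848635: `OneDimAutRepH.ext_of_xiLocalChar_eq_of_not_mem` (+ ★ p848593 local Hilbert 90, ★ p848366 torus rigidity)
import Literature.NumberTheory.Automorphic.SmoothCharacterOfCharacter                            -- ★ §4 (p848450): `eq_of_singleton_mk_ofChar_eq`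
import HarnessLib

/-!
# (PK-A-H) RIGIDITY — the global `H`-input `hglobH` DISCHARGED for a CHARACTER-INDEXED discreteness predicate: (L3) `XiRigidityH` from the kit laws,
# the A-fibre, Satake, and «every `DiscH`-discrete `H`-packet is a character packet `ρ(ξ′)`» — kit-generic (Rogawski §13.3 p. 203; §13.1 p. 199; §12.1)

Cell `hodgecm-mathlib`, F0∕P3c line LH7 (closer stub `stub_PKtuple : PKtupleLetter`, `Cruxes/H413/Lines/F0_U3LettersRung1.lean` ED. 38∕40, row #181), crux H413 =
`stmt-HodgeConjecture-24833`; organ payer LH7-p03 (g0), DEFAULT organ «HGLOB-CHAR» (LH7 bus 03:2xZ).  `--supports stmt-HodgeConjecture-24833`; closes no stub; touches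
neither `𝔩.pair` nor the `ε` slot.

THE MATHEMATICS.  ★ p848117 `xiRigidityH_of_fibre` reduces (L3) `XiRigidityH hH ψ νG tXi` to kit laws + the A-fibre + Satake (all in-house) + ONE global input
`hglobH`: «a `DiscH`-discrete `H`-packet `ρ` with the ξ-germ that equals `ξ` off a finite set `T` equals `ξ` everywhere».  When the discreteness predicate is
CHARACTER-INDEXED — every spectral `H`-packet is, on its finite part, one of the tuple's character packets: `∀ ρ, ∃ ξ′, ρ.fin = (rhoXiS hH ξ′).fin` (print: the
discrete `ρ ∈ Π(H)` with `Π(ρ) ∈ Π_a` are the one-dimensional `ξ′`, §13.3 p. 203, «`Π_a` and `Π_e` disjoint» p. 202; for the intended kit this is the DEFINITION of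
`DiscH`) — `hglobH` is a theorem: `ρ.fin = ρ(ξ′)_f` and `ρ(ξ′)_v = ρ(ξ)_v` for `v ∉ T` give equal member sets `{⟦ξ′_v⟧} = {⟦ξ_v⟧}` (★ `memH_rhoXiS_loc`), hence equal
local characters `χ ξ′ v = χ ξ v` (★ `eq_of_singleton_mk_ofChar_eq`: the class of a one-dimensional representation determines the character), hence `ξ′ = ξ` by
STRONG MULTIPLICITY ONE FOR THE CHARACTERS OF `H` — hypothesis `hχ_rigid` on the character family `χ`, discharged at the letter's `χ ξ v := ξ.xiLocalChar v` by ★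
`OneDimAutRepH.ext_of_xiLocalChar_eq_of_not_mem` (p848635: local Hilbert 90 + `det` onto `E¹_v` + Tate density for the norm-one torus) — so `ρ.fin = ρ(ξ)_f`.

CONTENTS (namespace ★ 3g∕3r∕3t `…F0P3SpectralPacket.SpectralPacketH`):
* `fin_loc_eq_of_charDiscH` — the discharge of `hglobH` («equal off `T` ⇒ equal everywhere») from `hDisc` + `hχ_rigid`;
* **`xiRigidityH_of_charDiscH`** — (L3) from (KD3) + `hfibH` + (KG1) + (KG3′) + guard + `vol ≠ 0` + `hsph`∕`hadmn`∕`ht` + `hDisc` + `hχ_rigid` (NO global print input left on the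
  `H`-side beyond the kit's own design facts `hfibH`∕`hDisc`);
* `xiRigidityH_of_charDiscH_xiLocalChar` — the same at `χ ξ v := ξ.xiLocalChar v` (the letter's `H`-characters), `hχ_rigid` discharged by ★ p848635.
No instance, no notation, no named fact, no `sorry`.
HONEST LABEL: HC_CM is proved only modulo the 7 printed citations (2 remaining: hLiu418 = stmt-HodgeConjecture-24832, h413 = stmt-HodgeConjecture-24833) until rung 0 closes;
this file proves no printed statement — it discharges the global `H`-side input of the (PK-A-H) rigidity reduction for character-indexed kits.

References: [Rogawski1990] §13.3 Thm. 13.3.5 p. 202, p. 202 l. 16, p. 203; §13.1 p. 199; §12.1 p. 171; §12.2 p. 174; §13.7 p. 206.  [CasselsFrohlichANT1967] Ch. VII §4 Prop. 4.1,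
§7.4 Cor. (a).  [CartierCorvallis1979] §IV.1 Cor. 4.1.  [BushnellHenniart2006] §1.5.
-/

set_option autoImplicit false
-- the mandated namespace repeats `HodgeConjecture.HodgeConjecture`, as in every `Theorems/*.lean` of this sub-problem
set_option linter.dupNamespace false

noncomputable section

open NumberField IsDedekindDomain MeasureTheory
open scoped Matrix MatrixGroups

open Literature.NumberTheory Literature.NumberTheory.Automorphic Literature.NumberTheory.Automorphic.UnitaryGroup
open Literature.NumberTheory.Rogawski1990 Literature.NumberTheory.GaloisRepresentations
open Literature.RepresentationTheory.BorelWallach2000 Literature.RepresentationTheory.KonnoKonno2007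
open Summit.HodgeConjecture.HodgeConjecture.Cruxes.H413.F0P3InnerFormClassificationV6 (splitForm EvpData EqOff)
open Summit.HodgeConjecture.HodgeConjecture.Cruxes.H413.F0P3LocalPacketKit
open Summit.HodgeConjecture.HodgeConjecture.Cruxes.H413.F0P3ArchPacketKit

namespace Summit.HodgeConjecture.HodgeConjecture.Cruxes.H413.F0P3SpectralPacket.SpectralPacketH

open Summit.HodgeConjecture.HodgeConjecture.Cruxes.H413.F0P3GlobalPacket

/-! ## §1 `hglobH` for a character-indexed `DiscH` -/

section CharDisc

variable {L : Type} [Field L] [NumberField L] [IsCMField L] {H' : Matrix (Fin 3) (Fin 3) L}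
  {𝔩 : ∀ v : HeightOneSpectrum (𝓞 ↥(maximalRealSubfield L)), LocalPacketKit L H' v} {𝔞 : ArchPacketKit} {𝔞H : ArchPacketKitH 𝔞}
  {DiscH : GlobalPacketH 𝔩 → 𝔞H.PktInfH → Prop}
  {PkX : OneDimAutRepH L → ∀ v : HeightOneSpectrum (𝓞 ↥(maximalRealSubfield L)), CMLocalAPacket L H' v}
  {PkInfX : OneDimAutRepH L → LocalAPacket (GKIrrClass (uFormGroup (Fin 2) (Fin 1)))}
  {χ : OneDimAutRepH L → ∀ v : HeightOneSpectrum (𝓞 ↥(maximalRealSubfield L)),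
    (UnitaryGroup.cmDatum L 2 (Matrix.of fun i j : Fin 2 => if i.val + j.val + 1 = 2 then (1 : L) else 0)).Local v ×
      (UnitaryGroup.cmDatum L 1 (Matrix.of fun i j : Fin 1 => if i.val + j.val + 1 = 1 then (1 : L) else 0)).Local v →* ℂˣ}
  {hχ : ∀ (ξ : OneDimAutRepH L) (v : HeightOneSpectrum (𝓞 ↥(maximalRealSubfield L))),
    IsOpen (((χ ξ v).ker : Subgroup ((UnitaryGroup.cmDatum L 2 (Matrix.of fun i j : Fin 2 => if i.val + j.val + 1 = 2 then (1 : L) else 0)).Local v ×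
      (UnitaryGroup.cmDatum L 1 (Matrix.of fun i j : Fin 1 => if i.val + j.val + 1 = 1 then (1 : L) else 0)).Local v)) :
      Set ((UnitaryGroup.cmDatum L 2 (Matrix.of fun i j : Fin 2 => if i.val + j.val + 1 = 2 then (1 : L) else 0)).Local v ×
        (UnitaryGroup.cmDatum L 1 (Matrix.of fun i j : Fin 1 => if i.val + j.val + 1 = 1 then (1 : L) else 0)).Local v))}
  {εX : OneDimAutRepH L → HeightOneSpectrum (𝓞 ↥(maximalRealSubfield L)) → ℤ} {κHX : OneDimAutRepH L → ℤ}

/-- **`hglobH` DISCHARGED for a character-indexed `DiscH`**: if every spectral `H`-packet is, on its finite part, one of the character packets `ρ(ξ′)` (`hDisc`) and the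
character family `χ` is RIGID off finite sets (`hχ_rigid`: `χ ξ v = χ ξ′ v` for all `v ∉ T` ⇒ `ξ = ξ′` — strong multiplicity one for the characters of `H`), then a spectral `ρ`
that equals `ρ(ξ)` at every place outside a finite set `T` equals `ρ(ξ)` at every place. [cite: Rogawski1990, §13.3 p. 203, p. 202 l. 16; §13.1 p. 199; §12.1 p. 171] [cite: BushnellHenniart2006, §1.5] -/
theorem fin_loc_eq_of_charDiscH (hH : XiHPacketsSigned 𝔩 𝔞 𝔞H DiscH PkX PkInfX χ hχ εX κHX)
    (hDisc : ∀ ρ : SpectralPacketH 𝔩 𝔞 𝔞H DiscH, ∃ ξ' : OneDimAutRepH L, ρ.fin = (rhoXiS hH ξ').fin)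
    (hχ_rigid : ∀ (ξ ξ' : OneDimAutRepH L) (T : Finset (HeightOneSpectrum (𝓞 ↥(maximalRealSubfield L)))), (∀ v ∉ T, χ ξ v = χ ξ' v) → ξ = ξ')
    (ξ : OneDimAutRepH L) (ρ : SpectralPacketH 𝔩 𝔞 𝔞H DiscH) (T : Finset (HeightOneSpectrum (𝓞 ↥(maximalRealSubfield L))))
    (hoff : ∀ v ∉ T, ρ.fin.loc v = (rhoXiS hH ξ).fin.loc v) :
    ∀ v, ρ.fin.loc v = (rhoXiS hH ξ).fin.loc v := by
  obtain ⟨ξ', hρ⟩ := hDisc ρ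
  -- `χ ξ′ v = χ ξ v` off `T`, from the equal singleton member sets `{⟦ξ′_v⟧} = {⟦ξ_v⟧}`
  have hχeq : ∀ v ∉ T, χ ξ' v = χ ξ v := fun v hv => by
    have hmem : (𝔩 v).memH ((rhoXiS hH ξ').fin.loc v) = (𝔩 v).memH ((rhoXiS hH ξ).fin.loc v) := by
      rw [← hρ]
      exact congrArg _ (hoff v hv)
    rw [memH_rhoXiS_loc, memH_rhoXiS_loc] at hmem
    exact eq_of_singleton_mk_ofChar_eq (hχ ξ' v) (hχ ξ v) hmem
  have hξ : ξ' = ξ := hχ_rigid ξ' ξ T hχeq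
  subst hξ
  intro v
  rw [hρ]

end CharDisc

/-! ## §2 (L3) `XiRigidityH` for character-indexed kits [Thm. 13.3.5 for `H`; §13.3 p. 203] -/

section Rigidity

variable {L : Type} [Field L] [NumberField L] [IsCMField L] {H : Matrix (Fin 3) (Fin 3) L}
  {𝔩 : ∀ v : HeightOneSpectrum (𝓞 ↥(maximalRealSubfield L)), LocalPacketKit L (splitForm L 3) v} {𝔞 : ArchPacketKit} {𝔞H : ArchPacketKitH 𝔞}
  {DiscH : GlobalPacketH 𝔩 → 𝔞H.PktInfH → Prop}
  [∀ v : HeightOneSpectrum (𝓞 ↥(maximalRealSubfield L)), MeasurableSpace ((cmDatum L 3 (splitForm L 3)).Local v)]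
  [∀ v : HeightOneSpectrum (𝓞 ↥(maximalRealSubfield L)), BorelSpace ((cmDatum L 3 (splitForm L 3)).Local v)]
  [∀ v : HeightOneSpectrum (𝓞 ↥(maximalRealSubfield L)), MeasurableSpace ((cmDatum L 3 H).Local v)]
  [∀ v : HeightOneSpectrum (𝓞 ↥(maximalRealSubfield L)), BorelSpace ((cmDatum L 3 H).Local v)]
  {νG' : ∀ v : HeightOneSpectrum (𝓞 ↥(maximalRealSubfield L)), Measure ((cmDatum L 3 H).Local v)}
  [∀ v, (νG' v).IsMulLeftInvariant] [∀ v, IsFiniteMeasureOnCompacts (νG' v)]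
  {ψ : ∀ v : HeightOneSpectrum (𝓞 ↥(maximalRealSubfield L)), (cmDatum L 3 H).Local v ≃ₜ* (cmDatum L 3 (splitForm L 3)).Local v}
  {Pk' : OneDimAutRepH L → ∀ v : HeightOneSpectrum (𝓞 ↥(maximalRealSubfield L)), CMLocalAPacket L H v}
  {ram : OneDimAutRepH L → Finset (HeightOneSpectrum (𝓞 ↥(maximalRealSubfield L)))}
  {PkInf : OneDimAutRepH L → LocalAPacket (GKIrrClass (uFormGroup (Fin 2) (Fin 1)))}
  {χ : OneDimAutRepH L → ∀ v : HeightOneSpectrum (𝓞 ↥(maximalRealSubfield L)),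
    (UnitaryGroup.cmDatum L 2 (Matrix.of fun i j : Fin 2 => if i.val + j.val + 1 = 2 then (1 : L) else 0)).Local v ×
      (UnitaryGroup.cmDatum L 1 (Matrix.of fun i j : Fin 1 => if i.val + j.val + 1 = 1 then (1 : L) else 0)).Local v →* ℂˣ}
  {hχ : ∀ (ξ : OneDimAutRepH L) (v : HeightOneSpectrum (𝓞 ↥(maximalRealSubfield L))),
    IsOpen (((χ ξ v).ker : Subgroup ((UnitaryGroup.cmDatum L 2 (Matrix.of fun i j : Fin 2 => if i.val + j.val + 1 = 2 then (1 : L) else 0)).Local v ×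
      (UnitaryGroup.cmDatum L 1 (Matrix.of fun i j : Fin 1 => if i.val + j.val + 1 = 1 then (1 : L) else 0)).Local v)) :
      Set ((UnitaryGroup.cmDatum L 2 (Matrix.of fun i j : Fin 2 => if i.val + j.val + 1 = 2 then (1 : L) else 0)).Local v ×
        (UnitaryGroup.cmDatum L 1 (Matrix.of fun i j : Fin 1 => if i.val + j.val + 1 = 1 then (1 : L) else 0)).Local v))}
  {ε : OneDimAutRepH L → HeightOneSpectrum (𝓞 ↥(maximalRealSubfield L)) → ℤ} {κH : OneDimAutRepH L → ℤ}

/-- **(L3) `XiRigidityH` FOR A CHARACTER-INDEXED KIT** — ★ p848117 `xiRigidityH_of_fibre` with its global input `hglobH` DISCHARGED by §1: hypotheses = (KD3) + the A-fibre `hfibH` +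
(KG1) + (KG3′) + guard + `vol(K′_v) ≠ 0` + the record shapes `hsph`∕`hadmn`∕`ht` + «every spectral `H`-packet is a character packet on its finite part» (`hDisc`) + rigidity of the
character family off finite sets (`hχ_rigid`).  Satake at the good places is in-house (★ p848041). [cite: Rogawski1990, §13.3 Thm. 13.3.5 p. 202, p. 203; §13.7 p. 206; §13.1 p. 199] [cite: CartierCorvallis1979, §IV.1 Cor. 4.1] -/
theorem xiRigidityH_of_charDiscH {hH : XiHPacketsSigned 𝔩 𝔞 𝔞H DiscH (transportAPackets ψ Pk') PkInf χ hχ ε κH}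
    (hKD3 : ∀ (σ : GlobalPacketH 𝔩) (P P' : 𝔞H.PktInfH), DiscH σ P → DiscH σ P' → P = P')
    (hfibH : ∀ (ξ : OneDimAutRepH L) (v : HeightOneSpectrum (𝓞 ↥(maximalRealSubfield L))) (r : (𝔩 v).PktH),
      (transportAPackets ψ Pk' ξ v).πn ∈ (𝔩 v).mem ((𝔩 v).xiH r) → r = (rhoXiS hH ξ).fin.loc v)
    (h4 : ∀ v : HeightOneSpectrum (𝓞 ↥(maximalRealSubfield L)), (𝔩 v).UnramLaw)
    (hKG3 : ∀ (v : HeightOneSpectrum (𝓞 ↥(maximalRealSubfield L))) (P : (𝔩 v).Pkt), ∀ π ∈ (𝔩 v).mem P, π.IsAdmissible)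
    (S₀ : Finset (HeightOneSpectrum (𝓞 ↥(maximalRealSubfield L))))
    (hψK : ∀ v ∉ S₀, (cmLocalIntegralLevel L 3 H v).map (ψ v : (cmDatum L 3 H).Local v →* (cmDatum L 3 (splitForm L 3)).Local v) =
      cmLocalIntegralLevel L 3 (splitForm L 3) v)
    (hvol : ∀ v : HeightOneSpectrum (𝓞 ↥(maximalRealSubfield L)), (νG' v).real (cmLocalIntegralLevel L 3 H v : Set ((cmDatum L 3 H).Local v)) ≠ 0)
    (hsph : ∀ (ξ : OneDimAutRepH L), ∀ v ∉ ram ξ, (Pk' ξ v).πn.IsSpherical (cmLocalIntegralLevel L 3 H v))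
    (hadmn : ∀ (ξ : OneDimAutRepH L) (v : HeightOneSpectrum (𝓞 ↥(maximalRealSubfield L))), (Pk' ξ v).πn.IsAdmissible)
    {tXi : OneDimAutRepH L → EvpData L H}
    (ht : ∀ (ξ : OneDimAutRepH L), ∀ v ∉ ram ξ, tXi ξ v = (Pk' ξ v).πn.eigencharacter (cmLocalIntegralLevel L 3 H v) (νG' v))
    (hDisc : ∀ ρ : SpectralPacketH 𝔩 𝔞 𝔞H DiscH, ∃ ξ' : OneDimAutRepH L, ρ.fin = (rhoXiS hH ξ').fin)
    (hχ_rigid : ∀ (ξ ξ' : OneDimAutRepH L) (T : Finset (HeightOneSpectrum (𝓞 ↥(maximalRealSubfield L)))), (∀ v ∉ T, χ ξ v = χ ξ' v) → ξ = ξ') :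
    XiRigidityH hH ψ (fun w => (νG' w).map (ψ w)) tXi := by
  classical
  refine xiRigidityH_of_fibre hKD3 hfibH h4 hKG3 S₀ hψK hvol hsph hadmn ht fun ξ S ρ _ _ hoff => ?_
  exact fin_loc_eq_of_charDiscH hH hDisc hχ_rigid ξ ρ (S ∪ S₀ ∪ ram ξ) fun v hv => by
    simp only [Finset.mem_union, not_or] at hv
    exact hoff v hv.1.1 hv.1.2 hv.2

/-- **(L3) `XiRigidityH` AT THE LETTER'S `H`-CHARACTERS `χ ξ v := ξ.xiLocalChar v`** (`hχ := isOpen_ker_xiLocalChar`-shaped): `hχ_rigid` is ★ p848635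
`OneDimAutRepH.ext_of_xiLocalChar_eq_of_not_mem` (strong multiplicity one for the characters of `H`: local Hilbert 90, `det` onto `E¹_v`, Tate density for the norm-one torus), so the
ONLY `H`-side inputs left are the kit's design facts (KD3), `hfibH`, `hDisc`. [cite: Rogawski1990, §13.3 Thm. 13.3.5 p. 202, p. 203; §13.1 p. 199; §12.2 p. 174] [cite: CasselsFrohlichANT1967, Ch. VII §4 Prop. 4.1] -/
theorem xiRigidityH_of_charDiscH_xiLocalChar
    {hχ' : ∀ (ξ : OneDimAutRepH L) (v : HeightOneSpectrum (𝓞 ↥(maximalRealSubfield L))),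
      IsOpen ((((fun (ξ : OneDimAutRepH L) (v : HeightOneSpectrum (𝓞 ↥(maximalRealSubfield L))) => ξ.xiLocalChar v) ξ v).ker :
        Subgroup ((UnitaryGroup.cmDatum L 2 (Matrix.of fun i j : Fin 2 => if i.val + j.val + 1 = 2 then (1 : L) else 0)).Local v ×
          (UnitaryGroup.cmDatum L 1 (Matrix.of fun i j : Fin 1 => if i.val + j.val + 1 = 1 then (1 : L) else 0)).Local v)) :
        Set ((UnitaryGroup.cmDatum L 2 (Matrix.of fun i j : Fin 2 => if i.val + j.val + 1 = 2 then (1 : L) else 0)).Local v ×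
          (UnitaryGroup.cmDatum L 1 (Matrix.of fun i j : Fin 1 => if i.val + j.val + 1 = 1 then (1 : L) else 0)).Local v))}
    {hH : XiHPacketsSigned 𝔩 𝔞 𝔞H DiscH (transportAPackets ψ Pk') PkInf (fun ξ v => ξ.xiLocalChar v) hχ' ε κH}
    (hKD3 : ∀ (σ : GlobalPacketH 𝔩) (P P' : 𝔞H.PktInfH), DiscH σ P → DiscH σ P' → P = P')
    (hfibH : ∀ (ξ : OneDimAutRepH L) (v : HeightOneSpectrum (𝓞 ↥(maximalRealSubfield L))) (r : (𝔩 v).PktH),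
      (transportAPackets ψ Pk' ξ v).πn ∈ (𝔩 v).mem ((𝔩 v).xiH r) → r = (rhoXiS hH ξ).fin.loc v)
    (h4 : ∀ v : HeightOneSpectrum (𝓞 ↥(maximalRealSubfield L)), (𝔩 v).UnramLaw)
    (hKG3 : ∀ (v : HeightOneSpectrum (𝓞 ↥(maximalRealSubfield L))) (P : (𝔩 v).Pkt), ∀ π ∈ (𝔩 v).mem P, π.IsAdmissible)
    (S₀ : Finset (HeightOneSpectrum (𝓞 ↥(maximalRealSubfield L))))
    (hψK : ∀ v ∉ S₀, (cmLocalIntegralLevel L 3 H v).map (ψ v : (cmDatum L 3 H).Local v →* (cmDatum L 3 (splitForm L 3)).Local v) =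
      cmLocalIntegralLevel L 3 (splitForm L 3) v)
    (hvol : ∀ v : HeightOneSpectrum (𝓞 ↥(maximalRealSubfield L)), (νG' v).real (cmLocalIntegralLevel L 3 H v : Set ((cmDatum L 3 H).Local v)) ≠ 0)
    (hsph : ∀ (ξ : OneDimAutRepH L), ∀ v ∉ ram ξ, (Pk' ξ v).πn.IsSpherical (cmLocalIntegralLevel L 3 H v))
    (hadmn : ∀ (ξ : OneDimAutRepH L) (v : HeightOneSpectrum (𝓞 ↥(maximalRealSubfield L))), (Pk' ξ v).πn.IsAdmissible)
    {tXi : OneDimAutRepH L → EvpData L H}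
    (ht : ∀ (ξ : OneDimAutRepH L), ∀ v ∉ ram ξ, tXi ξ v = (Pk' ξ v).πn.eigencharacter (cmLocalIntegralLevel L 3 H v) (νG' v))
    (hDisc : ∀ ρ : SpectralPacketH 𝔩 𝔞 𝔞H DiscH, ∃ ξ' : OneDimAutRepH L, ρ.fin = (rhoXiS hH ξ').fin) :
    XiRigidityH hH ψ (fun w => (νG' w).map (ψ w)) tXi :=
  xiRigidityH_of_charDiscH hKD3 hfibH h4 hKG3 S₀ hψK hvol hsph hadmn ht hDisc
    fun _ _ T hT => OneDimAutRepH.ext_of_xiLocalChar_eq_of_not_mem T hT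

end Rigidity

end Summit.HodgeConjecture.HodgeConjecture.Cruxes.H413.F0P3SpectralPacket.SpectralPacketH

end
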